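import Summits.BirchSwinnertonDyer.BirchSwinnertonDyer.Theorems.SchneiderFreeAdditiveX3AnomalousTwistLocalLines
import Summits.BirchSwinnertonDyer.BirchSwinnertonDyer.Theorems.EisensteinPrimesResidualDevissageSplitLocalData
import Summits.BirchSwinnertonDyer.BirchSwinnertonDyer.Theorems.EisensteinPrimesAnomalousLocalMover
import HarnessLib

/-!
# Route `SchneiderFreeAdditiveX3` (K1 door), crux r3 `GordTwoBranchIMC` (stmt-BirchSwinnertonDyer-19177): THE LOCAL DATA AT `v̄` OF
# EVERY `Γ_K`-STABLE LINE OF `W_K[3]` FOR THE ANOMALOUS `(−3)`-TWIST — `D_v̄` fixes the line pointwise (and inertia moves the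
# quotient), or inertia moves the line and `D_v̄` is trivial on the quotient (Keller–Yin's orientation `(ω, 𝟙)`)

Cell `bsd-schneider-ideate`, seat `bsd-schneider-door-c5` (prover, generation 31; assembly layer; `--supports` 19177, helper).
PARTITION: board row B6 ∩ X3 ∩ sst-twist, `r = 1` — the 1 725 ANOMALOUS pairs of the (G-ord, `e = 2`) half at `p = 3` (of 2 411).
bears_on: K1-door (items 18971/18972 retired → 19177 r3).  FILE 2 of the port of cell `bsd-eis`'s V21 INDEX ROAD (Keller–Yin
arXiv:2402.12781 Thm. 1.4.1 (iii)) to the door's ANOMALOUS TWIN `W = C • V^{(−3)}` (FINDING-door-c5-g28 §5b `stub_λW`): the `K`-level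
transport of FILE 1's dichotomy (`…AnomalousTwistLocalLines.fix_or_quot_of_anomalous_pStar_twist`), i.e. the door analogue of x2-p2 g10's
`ResidualDevissageSplitLocalData.localData_of_split`, whose transport is copied verbatim: `t : W[3](ℚ̄) ≅ W_K[3](K̄)`
(`exists_geomTorsion_baseChange_equiv`), the open setwise stabiliser of `t⁻¹(S)`, CHL's degree-one lemma
`decompositionSubgroup_le_of_decomp_le` (`D_𝔔 ≤ Stab`), `res(D_v̄) ≤ D_𝔔` (`comap_decompositionSubgroup_comap_absIntegersMap`) and
`res(I_v̄) = I_𝔔` (x1's `map_absGaloisRestrict_inertia_eq_of_split`) for the inertia witnesses.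

`localData_of_anomalousTwist`: `V/ℚ` globally minimal, good ordinary at `p = 3` with `3 ∣ a₃(V) − 1`, `W = C • V^{(p*)}`; `K` imaginary
quadratic with `3 = v v̄` split; `S ≤ W_K[3]` any `Γ_K`-stable subgroup of order `3` (`StableSubgroup`): `#(W_K[3]/S) = 3` and EITHER `D_v̄`
fixes `S` pointwise and some `g ∈ I_v̄` moves `W_K[3]/S` («`(θsub, θquot)|_{G_v̄} = (𝟙, ω)`», the orientation EXCLUDED by Keller–Yin's
lattice normalisation, arXiv:2410.23241 §3.3) OR some `g ∈ I_v̄` moves `S` and `D_v̄` is trivial on `W_K[3]/S` («`(ω, 𝟙)`», x1's orientation,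
on which the V21 producers run verbatim).

HONEST FRAMING: unconditional helper theorem (no definition, no named fact, no `sorry`); nothing analytic; no item closed; BSD
proved for no curve; «closes rung: none».  References: Keller–Yin arXiv:2402.12781v2 §1.3 Prop. 1.3.1, §1.4 [KellerYin2024]; Neukirch
ANT I §9 (9.4)–(9.6) [NeukirchANT1999]; Silverman AEC X.5 Cor. 5.4 [SilvermanAEC2009]; x2 `ResidualDevissageSplitLocalData` (template).
-/

set_option autoImplicit false
set_option linter.dupNamespace false

noncomputable section

open scoped Classical NumberField Pointwise

open WeierstrassCurve NumberField IsDedekindDomain Field Rat.HeightOneSpectrum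
  Literature.NumberTheory.EllipticCurves Literature.NumberTheory.GaloisRepresentations
  Literature.NumberTheory.EllipticCurves.Rank1Residual Literature.NumberTheory.EllipticCurves.GreenbergSelmer
  Summit.BirchSwinnertonDyer.Rank1Residual Summit.BirchSwinnertonDyer.Rank1Residual.GaloisImage
  Summit.BirchSwinnertonDyer.Rank1Residual.Additive
  Summit.BirchSwinnertonDyer.BirchSwinnertonDyer.Theorems.SchneiderFreeAdditiveX3.SemistableTwistLocal
  Summit.BirchSwinnertonDyer.BirchSwinnertonDyer.Theorems.SchneiderFreeAdditiveX3.SemistableTwistLocalThree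

namespace Summit.BirchSwinnertonDyer.BirchSwinnertonDyer.Theorems.SchneiderFreeAdditiveX3.AnomalousTwistLocalData

/-! ### §2 Over `K`: the local data at `v̄` of EVERY `Γ_K`-stable line of `W_K[3]` -/

section KSide

open Summit.BirchSwinnertonDyer.BirchSwinnertonDyer.Theorems.SchneiderFreeAdditiveX3.AnomalousTwistLocalLines
  Summit.BirchSwinnertonDyer.BirchSwinnertonDyer.Theorems.CumulativeHeegnerInclusionAtThreeLineBaseChange
  Summit.BirchSwinnertonDyer.BirchSwinnertonDyer.Theorems.CumulativeHeegnerInclusionAtThreeStubB1LineDeterminant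
  Summit.BirchSwinnertonDyer.BirchSwinnertonDyer.Theorems.AdditiveKoly.SplitCompletion
  Summit.BirchSwinnertonDyer.Rank1Residual.X2.ResidualDevissageModules

variable {V : WeierstrassCurve ℚ} [V.IsElliptic] [V.IsGloballyMinimal] {p : ℕ} [hp : Fact p.Prime]
  (W : WeierstrassCurve ℚ) [W.IsElliptic]
  (K : Type) [Field K] [NumberField K] (vbar : HeightOneSpectrum (𝓞 K))

/-- **THE LOCAL DATA AT `v̄` OF EVERY `Γ_K`-STABLE LINE OF `W_K[3]` for the anomalous `(−3)`-twist** (`W = C • V^{(p*)}`, `p = 3`,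
`V` good ordinary with `3 ∣ a₃(V) − 1`; `K` imaginary quadratic with `3 = v v̄` split; `S ≤ W_K[3]` any `Γ_K`-stable subgroup of order
`3`): `#(W_K[3]/S) = 3`, and EITHER `D_v̄` fixes `S` pointwise and some `g ∈ I_v̄` moves the quotient («`(θsub, θquot)|_{G_v̄} = (𝟙, ω)`»,
the orientation EXCLUDED by Keller–Yin's lattice normalisation), OR some `g ∈ I_v̄` moves `S` and `D_v̄` is trivial on `W_K[3]/S`
(«`(ω, 𝟙)`», x1's orientation).  §1(C) for `t⁻¹(S) ≤ W[3](ℚ̄)` along an equivariant `t : W[3] ≅ W_K[3]` at the contraction `𝔔` of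
`𝔓_{v̄}` (open setwise stabiliser + CHL's degree-one lemma `decompositionSubgroup_le_of_decomp_le`: `D_𝔔 ≤ Stab(t⁻¹S)`, and
`res(D_v̄) ≤ D_𝔔`; `res(I_v̄) = I_𝔔` by `map_absGaloisRestrict_inertia_eq_of_split`) — x2-p2 g10's `localData_of_split` transport verbatim.
UNCONDITIONAL. [cite: KellerYin2024, §1.3 Prop. 1.3.1, §1.4 Thm. 1.4.1 (iii) (arXiv:2402.12781v2)] [cite: NeukirchANT1999, Ch. I §9 Prop. (9.4)–(9.6)]
[cite: SilvermanAEC2009, X.5 Cor. 5.4] -/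
theorem localData_of_anomalousTwist (hp3 : p = 3) (hV : GoodOrd V p) (ha : (p : ℤ) ∣ V.frobeniusTrace p - 1)
    (C : VariableChange ℚ) (hC : C • V.quadraticTwist ((-1 : ℚ) ^ (p / 2) * p) = W)
    (hK : IsImaginaryQuadratic K) {v : HeightOneSpectrum (𝓞 K)} (hpvK : ((p : ℕ) : 𝓞 K) ∈ v.asIdeal)
    (hvbar : ((p : ℕ) : 𝓞 K) ∈ vbar.asIdeal) (hne : vbar ≠ v)
    (S : StableSubgroup (absoluteGaloisGroup K) ((W.baseChange K).geomTorsion ((p : ℕ) : ℤ)))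
    (hSub : Nat.card S.Sub = p) :
    Nat.card S.Quot = p ∧
      (((∀ g ∈ decomp vbar, ∀ x : S.Sub, g • x = x) ∧ (∃ g ∈ inertia vbar, ∃ y : S.Quot, g • y ≠ y)) ∨
       ((∃ g ∈ inertia vbar, ∃ x : S.Sub, g • x ≠ x) ∧ (∀ g ∈ decomp vbar, ∀ y : S.Quot, g • y = y))) := by
  have hpp : p.Prime := hp.out
  haveI hEK : (W.baseChange K).IsElliptic := inferInstanceAs (W.map (algebraMap ℚ K)).IsElliptic
  haveI : Algebra.IsQuadraticExtension ℚ K := ⟨hK.1⟩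
  obtain ⟨⟨he, hf⟩, -⟩ := LocalField.ramificationIdx_eq_one_and_inertiaDeg_eq_one_of_ne p vbar v hne hvbar hpvK
  set u : HeightOneSpectrum (𝓞 ℚ) := vbar.under (𝓞 ℚ) with hu
  have hw : vbar.asIdeal.under (𝓞 ℚ) = u.asIdeal := by rw [hu, HeightOneSpectrum.under_asIdeal]
  have hpv : ((p : ℕ) : 𝓞 ℚ) ∈ u.asIdeal := AnomalousLocalTorsion.natCast_mem_under_rat (K := K) hvbar
  -- the line `Φ = t⁻¹(S)` over `ℚ̄`
  obtain ⟨t, ht⟩ := exists_geomTorsion_baseChange_equiv W K ((p : ℕ) : ℤ)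
  have ht' : ∀ (σ : absoluteGaloisGroup K) (P : W.geomTorsion ((p : ℕ) : ℤ)),
      t (absGaloisRestrict ℚ K σ • P) = σ • t P := fun σ P ↦ by
    rw [← resGal_eq_absGaloisRestrict]; exact ht σ P
  let Φ : AddSubgroup (W.geomTorsion ((p : ℕ) : ℤ)) := S.toAddSubgroup.comap t.toAddMonoidHom
  have hS : ∀ Q : (W.baseChange K).geomTorsion ((p : ℕ) : ℤ), Q ∈ S.toAddSubgroup ↔ t.symm Q ∈ Φ := fun Q ↦ by
    change Q ∈ S.toAddSubgroup ↔ t (t.symm Q) ∈ S.toAddSubgroup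
    rw [t.apply_symm_apply]
  have hΦmem : ∀ P : W.geomTorsion ((p : ℕ) : ℤ), P ∈ Φ ↔ t P ∈ S.toAddSubgroup := fun _ ↦ Iff.rfl
  have hΦcard : Nat.card Φ = p := by
    have e : Φ ≃ S.toAddSubgroup :=
      { toFun := fun x ↦ ⟨t x.1, x.2⟩
        invFun := fun y ↦ ⟨t.symm y.1, by
          change t (t.symm y.1) ∈ S.toAddSubgroup
          rw [t.apply_symm_apply]; exact y.2⟩
        left_inv := fun x ↦ Subtype.ext (t.symm_apply_apply x.1)
        right_inv := fun y ↦ Subtype.ext (t.apply_symm_apply y.1) }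
    have h : Nat.card Φ = Nat.card S.Sub := Nat.card_congr e
    exact h.trans hSub
  -- `Φ` is stable under `res(Γ_K)`, hence under `D_𝔓` for the prime `𝔓` under the chosen prime of `v̄` (degree-one transport)
  have hresst : ∀ (γ : absoluteGaloisGroup K), ∀ P ∈ Φ, absGaloisRestrict ℚ K γ • P ∈ Φ := fun γ P hP ↦ by
    rw [hΦmem, ht']
    exact S.smul_mem' γ ((hΦmem P).mp hP)
  -- the setwise stabiliser of `Φ`, an open subgroup of `Γ_ℚ`
  let T : Subgroup (absoluteGaloisGroup ℚ) :=
    { carrier := {g | Φ.map (DistribSMul.toAddMonoidHom (W.geomTorsion ((p : ℕ) : ℤ)) g) = Φ}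
      mul_mem' := fun {a b} ha hb ↦ by
        change Φ.map (DistribSMul.toAddMonoidHom _ (a * b)) = Φ
        have e : DistribSMul.toAddMonoidHom (W.geomTorsion ((p : ℕ) : ℤ)) (a * b) =
            (DistribSMul.toAddMonoidHom _ a).comp (DistribSMul.toAddMonoidHom _ b) :=
          AddMonoidHom.ext fun P ↦ mul_smul a b P
        rw [e, ← AddSubgroup.map_map]
        change Φ.map (DistribSMul.toAddMonoidHom _ b) = Φ at hb
        change Φ.map (DistribSMul.toAddMonoidHom _ a) = Φ at ha
        rw [hb, ha]
      one_mem' := by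
        change Φ.map (DistribSMul.toAddMonoidHom _ (1 : absoluteGaloisGroup ℚ)) = Φ
        have e : DistribSMul.toAddMonoidHom (W.geomTorsion ((p : ℕ) : ℤ)) (1 : absoluteGaloisGroup ℚ) = AddMonoidHom.id _ :=
          AddMonoidHom.ext fun P ↦ one_smul _ P
        rw [e, AddSubgroup.map_id]
      inv_mem' := fun {a} ha ↦ by
        change Φ.map (DistribSMul.toAddMonoidHom _ a) = Φ at ha
        change Φ.map (DistribSMul.toAddMonoidHom _ a⁻¹) = Φ
        have e : (DistribSMul.toAddMonoidHom (W.geomTorsion ((p : ℕ) : ℤ)) a⁻¹).comp (DistribSMul.toAddMonoidHom _ a) =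
            AddMonoidHom.id _ :=
          AddMonoidHom.ext fun P ↦ inv_smul_smul a P
        conv_lhs => rw [← ha, AddSubgroup.map_map, e, AddSubgroup.map_id] }
  have hTmem : ∀ g : absoluteGaloisGroup ℚ, g ∈ T ↔ Φ.map (DistribSMul.toAddMonoidHom (W.geomTorsion ((p : ℕ) : ℤ)) g) = Φ :=
    fun _ ↦ Iff.rfl
  have hTst : ∀ g ∈ T, ∀ P ∈ Φ, g • P ∈ Φ := fun g hg P hP ↦ by
    rw [hTmem] at hg
    rw [← hg]
    exact AddSubgroup.mem_map.mpr ⟨P, hP, rfl⟩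
  have hT_of : ∀ g : absoluteGaloisGroup ℚ, (∀ P ∈ Φ, g • P ∈ Φ) → (∀ P ∈ Φ, g⁻¹ • P ∈ Φ) → g ∈ T := fun g h1 h2 ↦ by
    rw [hTmem]
    ext P
    constructor
    · rintro ⟨R, hR, rfl⟩
      exact h1 R hR
    · intro hP
      exact AddSubgroup.mem_map.mpr ⟨g⁻¹ • P, h2 P hP, smul_inv_smul g P⟩
  have hTopen : IsOpen (T : Set (absoluteGaloisGroup ℚ)) := by
    refine Subgroup.isOpen_mono ?_ (isOpen_iInf_stabilizer_geomTorsion W p)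
    intro g hg
    have hgP : ∀ P : W.geomTorsion ((p : ℕ) : ℤ), g • P = P := fun P ↦ by
      have h := (Subgroup.mem_iInf.mp hg) P
      exact Subtype.ext (by rw [AddSubgroup.torsionBy.coe_smul]; exact h)
    refine hT_of g (fun P hP ↦ by rw [hgP P]; exact hP) (fun P hP ↦ ?_)
    have h := hgP (g⁻¹ • P)
    rw [smul_inv_smul] at h
    rw [← h]; exact hP
  have hle : ∀ γ ∈ decomp vbar, absGaloisRestrict ℚ K γ ∈ T := fun γ _ ↦
    hT_of _ (hresst γ) (fun P hP ↦ by rw [← map_inv]; exact hresst γ⁻¹ P hP)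
  set 𝔔 := adicCompletionPrime K vbar with h𝔔def
  have h𝔔 : 𝔔 ∈ vbar.primesAbove := adicCompletionPrime_mem_primesAbove K vbar
  set 𝔓 := 𝔔.comap (absIntegersMap ℚ K) with h𝔓def
  have h𝔓 : 𝔓 ∈ u.primesAbove := comap_absIntegersMap_mem_primesAbove hw h𝔔
  have hDT : 𝔓.decompositionSubgroup (absoluteGaloisGroup ℚ) ≤ T :=
    decompositionSubgroup_le_of_decomp_le K hw he hf T hTopen hle
  -- `res(decomp v̄) ⊆ D_𝔓`
  have hres : ∀ γ ∈ decomp vbar, absGaloisRestrict ℚ K γ ∈ 𝔓.decompositionSubgroup (absoluteGaloisGroup ℚ) := by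
    intro γ hγ
    have hDw : 𝔔.decompositionSubgroup (absoluteGaloisGroup K) = decomp vbar := by
      rw [h𝔔def, decompositionSubgroup_adicCompletionPrime_eq_range]; rfl
    have h : γ ∈ (𝔓.decompositionSubgroup (absoluteGaloisGroup ℚ)).comap (absGaloisRestrict ℚ K).toMonoidHom := by
      rw [h𝔓def, comap_decompositionSubgroup_comap_absIntegersMap ℚ K 𝔔, hDw]; exact hγ
    exact h
  -- `res(inertia v̄) = I_𝔓`
  obtain ⟨hresI, -⟩ := AnomalousLocalTorsion.map_absGaloisRestrict_inertia_eq_of_split (p := p) hK hpvK hvbar hne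
  have hinert : ∀ τ ∈ 𝔓.inertia (absoluteGaloisGroup ℚ), ∃ γ ∈ inertia vbar, absGaloisRestrict ℚ K γ = τ := by
    intro τ hτ
    have hτ' : τ ∈ (inertia vbar).map (absGaloisRestrict ℚ K).toMonoidHom := by rw [hresI]; exact hτ
    obtain ⟨γ, hγ, hγτ⟩ := Subgroup.mem_map.mp hτ'
    exact ⟨γ, hγ, hγτ⟩
  -- §1(C) at `𝔓`
  have hΦst : ∀ g ∈ 𝔓.decompositionSubgroup (absoluteGaloisGroup ℚ), ∀ P ∈ Φ, g • P ∈ Φ := fun g hg ↦ hTst g (hDT hg)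
  have hEp : Nat.card ((W.baseChange K).geomTorsion ((p : ℕ) : ℤ)) = p ^ 2 := (W.baseChange K).natCard_geomTorsion_prime_eq_sq hpp
  have hQuot : Nat.card S.Quot = p := by
    have h := S.natCard_eq_mul
    rw [hEp, hSub, sq] at h
    exact (Nat.eq_of_mul_eq_mul_right hpp.pos h).symm
  refine ⟨hQuot, ?_⟩
  -- reading a `ℚ̄`-level identity on `S.Sub` / `S.Quot`
  have hsubK : ∀ (γ : absoluteGaloisGroup K) (x : S.Sub),
      absGaloisRestrict ℚ K γ • t.symm (S.incl x) = t.symm (S.incl x) → γ • x = x := by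
    intro γ x h1
    apply S.incl_injective
    rw [StableSubgroup.incl_smul]
    have h2 := congrArg t h1
    rw [ht', t.apply_symm_apply] at h2
    exact h2
  have hmemx : ∀ x : S.Sub, t.symm (S.incl x) ∈ Φ := fun x ↦
    (hS _).mp (by rw [← S.range_incl]; exact ⟨x, rfl⟩)
  rcases fix_or_quot_of_anomalous_pStar_twist hp3 hV ha C hC hpv h𝔓 hΦcard hΦst with ⟨hfix, τ, hτI, P, hP⟩ | ⟨⟨τ, hτI, P, hPΦ, hP⟩, hquot⟩
  · -- `D_{v̄}` fixes `S` pointwise; an inertia element moves the quotient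
    refine Or.inl ⟨fun γ hγ x ↦ hsubK γ x (hfix _ (hres γ hγ) _ (hmemx x)), ?_⟩
    obtain ⟨γ, hγ, hγτ⟩ := hinert τ hτI
    refine ⟨γ, hγ, S.proj (t P), fun h ↦ hP ?_⟩
    rw [S.smul_proj, ← sub_eq_zero, ← map_sub, ← AddMonoidHom.mem_ker, S.ker_proj] at h
    rw [hΦmem, map_sub, ← hγτ, ht']
    exact h
  · -- an inertia element moves `S`; `D_{v̄}` acts trivially on `W_K[p]/S`
    refine Or.inr ⟨?_, fun γ hγ ↦ (S.forall_smul_quot_eq_self_iff γ).mpr fun Q ↦ ?_⟩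
    · obtain ⟨γ, hγ, hγτ⟩ := hinert τ hτI
      have hPS : t P ∈ S.toAddSubgroup := (hΦmem P).mp hPΦ
      obtain ⟨x, hx⟩ : ∃ x : S.Sub, S.incl x = t P := by
        have : t P ∈ S.incl.range := by rw [S.range_incl]; exact hPS
        exact this
      refine ⟨γ, hγ, x, fun h ↦ hP ?_⟩
      have h1 := congrArg (fun y : S.Sub ↦ t.symm (S.incl y)) h
      simp only [StableSubgroup.incl_smul] at h1
      rw [hx, ← ht', t.symm_apply_apply, t.symm_apply_apply, hγτ] at h1
      exact h1
    · have h1 := hquot _ (hres γ hγ) (t.symm Q)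
      rw [hΦmem, map_sub, ht', t.apply_symm_apply] at h1
      exact h1

end KSide

end Summit.BirchSwinnertonDyer.BirchSwinnertonDyer.Theorems.SchneiderFreeAdditiveX3.AnomalousTwistLocalData

end
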